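import Summits.MatrixMultiplication.OmegaCensus.Z4Z4CubeTables
import HarnessLib

/-!
# No cube law triple of shape `(3,3 | 3,3 | e,e)` over `A ↠ ℤ₄ × ℤ₄`

ω-census `pub-omega`, family (b3), seat pub-omega-group gen 14.  Framing: lottery ticket; floor = certified bounds/negative
ranges.  VALUE: a kernel theorem about the group-theoretic method; NOT progress on ω.  Companion of
`DominoPartThreeZ4Z4.lean` for the THREE-SET cube shapes with two parts of size `3`.
**Theorem (`no_law_cube_33e_of_onto_z4z4`, rotations `_e33_`, `_3e3_`).** Dihedral-like `G` over `A` (any `c₀`),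
`A ↠ ZMod 4 × ZMod 4`: no TPP triple with coset parts `|S₀| = |S₁| = 3`, `|T₀| = |T₁| = 3`, `|U₀| = |U₁|` attains
`3|S||T||U| + 8 = 8|A|`.  Census: cells `(3,3,13)` at `|A| = 352` (`ℤ₄ × ℤ₈ × ℤ₁₁`), `(3,3,29)` at `784` (`ℤ₄² × ℤ₄₉`, `ℤ₄² × ℤ₇²`).
*Proof.* `cube_shifted_form_of_law` + `cube_form_charsum` give `(E_w) ψ(κ₁) c̄ a b + ψ(κ₂) c ā b + ψ(κ₃) c a b̄ = −ψ(x₀)`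
for the characters `ψ_w` of `ℤ₄²`; real characters put `W`, `X` in general position and `κ̄₁ ≠ κ̄₂`; in coordinates adapted to
`W`, multiplying `(E_w)` by `ξ̄η̄` (`ξ = ψ_w(x₁)`, `η = ψ_w(y₁)`) gives the normal form of `table33_two_add_i` /
`table33_one_add_two_i` (`Z4Z4CubeTables.lean`), forcing the exceptional relations since `b ≠ 0`; `combine33` says the
relations at `w, w', w + w'` are incompatible.  ∎
-/

namespace Summit.MatrixMultiplication.OmegaCensus

open Literature.Combinatorics.Additive Finset

/-! ## The core: no three-set form with `|W| = |X| = 3` over `A ↠ ℤ₄²` -/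

section Main

variable {A : Type*} [AddCommGroup A] [Fintype A] [DecidableEq A]

/-- **Core theorem.**  `Φ : A ↠ ZMod 4 × ZMod 4`; `W`, `X` of size `3`, `Y` of odd size, shifts `κ₁ κ₂ κ₃` and `x₀` with the
three-set shifted form.  Then `False`. [folklore] -/
theorem no_cube_form_33_of_onto_z4z4 (Φ : A →+ ZMod 4 × ZMod 4) (hΦ : Function.Surjective Φ)
    {W X Y : Finset A} {κ₁ κ₂ κ₃ x₀ : A} (hW : W.card = 3) (hX : X.card = 3) (hY : Odd Y.card)
    (i₁ : Set.InjOn (fun p : A × A × A => p.1 + p.2.1 + p.2.2) ↑((W.image fun w => κ₁ - w) ×ˢ X ×ˢ Y))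
    (i₂ : Set.InjOn (fun p : A × A × A => p.1 + p.2.1 + p.2.2) ↑(W ×ˢ (X.image fun x => κ₂ - x) ×ˢ Y))
    (i₃ : Set.InjOn (fun p : A × A × A => p.1 + p.2.1 + p.2.2) ↑(W ×ˢ X ×ˢ (Y.image fun y => κ₃ - y)))
    (d₁₂ : Disjoint (((W.image fun w => κ₁ - w) ×ˢ X ×ˢ Y).image fun p : A × A × A => p.1 + p.2.1 + p.2.2)
      ((W ×ˢ (X.image fun x => κ₂ - x) ×ˢ Y).image fun p : A × A × A => p.1 + p.2.1 + p.2.2))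
    (d₁₃ : Disjoint (((W.image fun w => κ₁ - w) ×ˢ X ×ˢ Y).image fun p : A × A × A => p.1 + p.2.1 + p.2.2)
      ((W ×ˢ X ×ˢ (Y.image fun y => κ₃ - y)).image fun p : A × A × A => p.1 + p.2.1 + p.2.2))
    (d₂₃ : Disjoint ((W ×ˢ (X.image fun x => κ₂ - x) ×ˢ Y).image fun p : A × A × A => p.1 + p.2.1 + p.2.2)
      ((W ×ˢ X ×ˢ (Y.image fun y => κ₃ - y)).image fun p : A × A × A => p.1 + p.2.1 + p.2.2))
    (hcover : (((W.image fun w => κ₁ - w) ×ˢ X ×ˢ Y).image fun p : A × A × A => p.1 + p.2.1 + p.2.2) ∪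
      ((W ×ˢ (X.image fun x => κ₂ - x) ×ˢ Y).image fun p : A × A × A => p.1 + p.2.1 + p.2.2) ∪
      ((W ×ˢ X ×ˢ (Y.image fun y => κ₃ - y)).image fun p : A × A × A => p.1 + p.2.1 + p.2.2) = univ.erase x₀) :
    False := by
  classical
  obtain ⟨x₁, x₂, x₃, hx12, hx13, hx23, rfl⟩ := card_eq_three.1 hW
  obtain ⟨y₁, y₂, y₃, hy12, hy13, hy23, rfl⟩ := card_eq_three.1 hX
  obtain ⟨ψ, hψ⟩ : ∃ ψ : ZMod 4 × ZMod 4 → A → GaussianInt,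
      ∀ w a, ψ w a = (⟨0, 1⟩ : GaussianInt) ^ (w.1 * (Φ a).1 + w.2 * (Φ a).2).val := ⟨_, fun _ _ => rfl⟩
  have hψadd : ∀ w a b, ψ w (a + b) = ψ w a * ψ w b := fun w a b => by
    rw [hψ, hψ, hψ]; exact z4char_add Φ w a b
  have hψneg : ∀ w a, ψ w (-a) = star (ψ w a) := fun w a => by rw [hψ, hψ]; exact z4char_neg Φ w a
  have hψww : ∀ w w' a, ψ (w + w') a = ψ w a * ψ w' a := fun w w' a => by
    rw [hψ, hψ, hψ, z4pair_add_left, ipow_add]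
  have hψsum : ∀ w, w ≠ 0 → ∑ a, ψ w a = 0 := fun w hw => by
    simp only [hψ]; exact z4char_sum_eq_zero Φ hΦ w hw
  have hψunit : ∀ w a, ψ w a * star (ψ w a) = 1 := fun w a => by rw [hψ]; exact ipow_mul_star _
  have hB : ∀ w, (∑ v ∈ Y, ψ w v) ≠ 0 := fun w => by simp only [hψ]; exact z4char_sum_ne_zero Φ w hY
  have E : ∀ w : ZMod 4 × ZMod 4, w ≠ 0 →
      ψ w κ₁ * star (ψ w x₁ + ψ w x₂ + ψ w x₃) * (ψ w y₁ + ψ w y₂ + ψ w y₃) * (∑ v ∈ Y, ψ w v) +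
        ψ w κ₂ * (ψ w x₁ + ψ w x₂ + ψ w x₃) * star (ψ w y₁ + ψ w y₂ + ψ w y₃) * (∑ v ∈ Y, ψ w v) +
        ψ w κ₃ * (ψ w x₁ + ψ w x₂ + ψ w x₃) * (ψ w y₁ + ψ w y₂ + ψ w y₃) * star (∑ v ∈ Y, ψ w v) +
        ψ w x₀ = 0 := by
    intro w hw
    have h := cube_form_charsum (ψ w) (hψadd w) i₁ i₂ i₃ d₁₂ d₁₃ d₂₃ hcover
    rw [hψsum w hw] at h
    simp only [sum_insert (show x₁ ∉ ({x₂, x₃} : Finset A) by simp [hx12, hx13]),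
      sum_insert (show y₁ ∉ ({y₂, y₃} : Finset A) by simp [hy12, hy13]), sum_pair hx23, sum_pair hy23] at h
    simp only [hψneg] at h
    rw [star_add, star_add, star_add, star_add, star_sum]
    linear_combination -h
  have hψx : ∀ w b, ψ w b = ψ w x₁ * (⟨0, 1⟩ : GaussianInt) ^ (w.1 * (Φ (b - x₁)).1 + w.2 * (Φ (b - x₁)).2).val :=
    fun w b => by rw [← hψ, ← hψadd, add_sub_cancel]
  have hψy : ∀ w b, ψ w b = ψ w y₁ * (⟨0, 1⟩ : GaussianInt) ^ (w.1 * (Φ (b - y₁)).1 + w.2 * (Φ (b - y₁)).2).val :=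
    fun w b => by rw [← hψ, ← hψadd, add_sub_cancel]
  have three_ndvd : ∀ (c : GaussianInt) (w : ZMod 4 × ZMod 4) (a : A), 3 * c ≠ -ψ w a := by
    intro c w a h
    have := congrArg Zsqrtd.norm h
    rw [Zsqrtd.norm_mul, Zsqrtd.norm_neg, hψ, norm_ipow] at this
    have h9 : (3 : GaussianInt).norm = 9 := by decide
    rw [h9] at this
    omega
  have RW : ∀ w : ZMod 4 × ZMod 4, w ≠ 0 → (∀ a, star (ψ w a) = ψ w a) →
      ¬ ((⟨0, 1⟩ : GaussianInt) ^ (w.1 * (Φ (x₂ - x₁)).1 + w.2 * (Φ (x₂ - x₁)).2).val = 1 ∧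
         (⟨0, 1⟩ : GaussianInt) ^ (w.1 * (Φ (x₃ - x₁)).1 + w.2 * (Φ (x₃ - x₁)).2).val = 1) := by
    rintro w hw hreal ⟨h1, h2⟩
    have h := E w hw
    rw [hψx w x₂, hψx w x₃, h1, h2, mul_one] at h
    simp only [star_add, star_sum, hreal] at h
    apply three_ndvd (ψ w x₁ * (ψ w y₁ + ψ w y₂ + ψ w y₃) * (∑ v ∈ Y, ψ w v) * (ψ w κ₁ + ψ w κ₂ + ψ w κ₃)) w x₀
    linear_combination h
  have RX : ∀ w : ZMod 4 × ZMod 4, w ≠ 0 → (∀ a, star (ψ w a) = ψ w a) →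
      ¬ ((⟨0, 1⟩ : GaussianInt) ^ (w.1 * (Φ (y₂ - y₁)).1 + w.2 * (Φ (y₂ - y₁)).2).val = 1 ∧
         (⟨0, 1⟩ : GaussianInt) ^ (w.1 * (Φ (y₃ - y₁)).1 + w.2 * (Φ (y₃ - y₁)).2).val = 1) := by
    rintro w hw hreal ⟨h1, h2⟩
    have h := E w hw
    rw [hψy w y₂, hψy w y₃, h1, h2, mul_one] at h
    simp only [star_add, star_sum, hreal] at h
    apply three_ndvd ((ψ w x₁ + ψ w x₂ + ψ w x₃) * ψ w y₁ * (∑ v ∈ Y, ψ w v) * (ψ w κ₁ + ψ w κ₂ + ψ w κ₃)) w x₀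
    linear_combination h
  have RK1 : ∀ w : ZMod 4 × ZMod 4, w + w ≠ 0 → ψ (w + w) κ₁ = ψ (w + w) κ₂ →
      ψ (w + w) κ₃ = -ψ (w + w) κ₁ := by
    intro w hw heq
    have hreal : ∀ a, star (ψ (w + w) a) = ψ (w + w) a := fun a => by rw [hψ, z4pair_two, star_ipow_two_mul]
    have h := E (w + w) hw
    rw [← heq] at h
    simp only [star_add, star_sum, hreal] at h
    have hcases : ψ (w + w) κ₃ = 1 ∨ ψ (w + w) κ₃ = -1 := by rw [hψ, z4pair_two]; exact ipow_two_mul_cases _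
    have hcases1 : ψ (w + w) κ₁ = 1 ∨ ψ (w + w) κ₁ = -1 := by rw [hψ, z4pair_two]; exact ipow_two_mul_cases _
    rcases hcases with h3 | h3 <;> rcases hcases1 with h1 | h1
    · exfalso
      apply three_ndvd ((ψ (w + w) x₁ + ψ (w + w) x₂ + ψ (w + w) x₃) * (ψ (w + w) y₁ + ψ (w + w) y₂ + ψ (w + w) y₃) *
        (∑ v ∈ Y, ψ (w + w) v)) (w + w) x₀
      rw [h3, h1] at h; linear_combination h
    · rw [h3, h1]; norm_num
    · rw [h3, h1]
    · exfalso
      apply three_ndvd (-((ψ (w + w) x₁ + ψ (w + w) x₂ + ψ (w + w) x₃) * (ψ (w + w) y₁ + ψ (w + w) y₂ + ψ (w + w) y₃) *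
        (∑ v ∈ Y, ψ (w + w) v))) (w + w) x₀
      rw [h3, h1] at h; linear_combination h
  have hreal2 : ∀ w : ZMod 4 × ZMod 4, ∀ a, star (ψ (w + w) a) = ψ (w + w) a := fun w a => by
    rw [hψ, z4pair_two, star_ipow_two_mul]
  have e20 : ∀ q : ZMod 4 × ZMod 4, ((1, 0) + (1, 0) : ZMod 4 × ZMod 4).1 * q.1 +
      ((1, 0) + (1, 0) : ZMod 4 × ZMod 4).2 * q.2 = 2 * q.1 + 0 * q.2 := fun q => by
    simp only [Prod.mk_add_mk]; ring
  have e02 : ∀ q : ZMod 4 × ZMod 4, ((0, 1) + (0, 1) : ZMod 4 × ZMod 4).1 * q.1 +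
      ((0, 1) + (0, 1) : ZMod 4 × ZMod 4).2 * q.2 = 0 * q.1 + 2 * q.2 := fun q => by
    simp only [Prod.mk_add_mk]; ring
  have e22 : ∀ q : ZMod 4 × ZMod 4, ((1, 1) + (1, 1) : ZMod 4 × ZMod 4).1 * q.1 +
      ((1, 1) + (1, 1) : ZMod 4 × ZMod 4).2 * q.2 = 2 * q.1 + 2 * q.2 := fun q => by
    simp only [Prod.mk_add_mk]; ring
  obtain ⟨w, w', hwP, hwQ, hw'P, hw'Q⟩ := exists_dual_pair (Φ (x₂ - x₁)) (Φ (x₃ - x₁))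
    (by rw [← e20, ← e20]; exact RW _ (by decide) (hreal2 _))
    (by rw [← e02, ← e02]; exact RW _ (by decide) (hreal2 _))
    (by rw [← e22, ← e22]; exact RW _ (by decide) (hreal2 _))
  have hw0 : w ≠ 0 := by
    rintro rfl
    simp only [Prod.fst_zero, Prod.snd_zero, zero_mul, add_zero] at hwP; exact absurd hwP (by decide)
  have hw'0 : w' ≠ 0 := by
    rintro rfl
    simp only [Prod.fst_zero, Prod.snd_zero, zero_mul, add_zero] at hw'Q; exact absurd hw'Q (by decide)
  have hww'P : (w + w').1 * (Φ (x₂ - x₁)).1 + (w + w').2 * (Φ (x₂ - x₁)).2 = 1 := by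
    rw [z4pair_add_left, hwP, hw'P, add_zero]
  have hww'Q : (w + w').1 * (Φ (x₃ - x₁)).1 + (w + w').2 * (Φ (x₃ - x₁)).2 = 1 := by
    rw [z4pair_add_left, hwQ, hw'Q, zero_add]
  have hww'0 : w + w' ≠ 0 := by
    intro h; rw [h] at hww'P
    simp only [Prod.fst_zero, Prod.snd_zero, zero_mul, add_zero] at hww'P; exact absurd hww'P (by decide)
  have h2w0 : w + w ≠ 0 := by
    intro h
    have := z4pair_two w (Φ (x₂ - x₁))
    rw [h, hwP, mul_one] at this
    simp only [Prod.fst_zero, Prod.snd_zero, zero_mul, add_zero] at this; exact absurd this (by decide)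
  have h2w'0 : w' + w' ≠ 0 := by
    intro h
    have := z4pair_two w' (Φ (x₃ - x₁))
    rw [h, hw'Q, mul_one] at this
    simp only [Prod.fst_zero, Prod.snd_zero, zero_mul, add_zero] at this; exact absurd this (by decide)
  have h2ww'0 : (w + w') + (w + w') ≠ 0 := by
    intro h
    have := z4pair_two (w + w') (Φ (x₂ - x₁))
    rw [h, hww'P, mul_one] at this
    simp only [Prod.fst_zero, Prod.snd_zero, zero_mul, add_zero] at this; exact absurd this (by decide)
  have hcw : ψ w x₁ + ψ w x₂ + ψ w x₃ = ψ w x₁ * ⟨2, 1⟩ := by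
    rw [hψx w x₂, hψx w x₃, hwP, hwQ, gi_two_one]; ring
  have hcw' : ψ w' x₁ + ψ w' x₂ + ψ w' x₃ = ψ w' x₁ * ⟨2, 1⟩ := by
    rw [hψx w' x₂, hψx w' x₃, hw'P, hw'Q, gi_two_one]; ring
  have hcww' : ψ (w + w') x₁ + ψ (w + w') x₂ + ψ (w + w') x₃ = ψ (w + w') x₁ * ⟨1, 2⟩ := by
    rw [hψx (w + w') x₂, hψx (w + w') x₃, hww'P, hww'Q, gi_one_two]; ring
  have ipow_one_of : ∀ m : ZMod 4, 2 * m = 0 → (⟨0, 1⟩ : GaussianInt) ^ (2 * m).val = 1 := by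
    intro m hm; rw [hm, ZMod.val_zero, pow_zero]
  have hX1 : ¬ (2 * (w.1 * (Φ (y₂ - y₁)).1 + w.2 * (Φ (y₂ - y₁)).2) = 0 ∧
      2 * (w.1 * (Φ (y₃ - y₁)).1 + w.2 * (Φ (y₃ - y₁)).2) = 0) := by
    rintro ⟨h1, h2⟩
    refine RX (w + w) h2w0 (hreal2 w) ⟨?_, ?_⟩
    · rw [z4pair_two]; exact ipow_one_of _ h1
    · rw [z4pair_two]; exact ipow_one_of _ h2
  have hX2 : ¬ (2 * (w'.1 * (Φ (y₂ - y₁)).1 + w'.2 * (Φ (y₂ - y₁)).2) = 0 ∧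
      2 * (w'.1 * (Φ (y₃ - y₁)).1 + w'.2 * (Φ (y₃ - y₁)).2) = 0) := by
    rintro ⟨h1, h2⟩
    refine RX (w' + w') h2w'0 (hreal2 w') ⟨?_, ?_⟩
    · rw [z4pair_two]; exact ipow_one_of _ h1
    · rw [z4pair_two]; exact ipow_one_of _ h2
  have hX3 : ¬ (2 * ((w.1 * (Φ (y₂ - y₁)).1 + w.2 * (Φ (y₂ - y₁)).2) + (w'.1 * (Φ (y₂ - y₁)).1 + w'.2 * (Φ (y₂ - y₁)).2)) = 0 ∧
      2 * ((w.1 * (Φ (y₃ - y₁)).1 + w.2 * (Φ (y₃ - y₁)).2) + (w'.1 * (Φ (y₃ - y₁)).1 + w'.2 * (Φ (y₃ - y₁)).2)) = 0) := by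
    rintro ⟨h1, h2⟩
    rw [← z4pair_add_left] at h1 h2
    refine RX ((w + w') + (w + w')) h2ww'0 (hreal2 (w + w')) ⟨?_, ?_⟩
    · rw [z4pair_two]; exact ipow_one_of _ h1
    · rw [z4pair_two]; exact ipow_one_of _ h2
  have hK : ¬ (2 * (((w.1 * (Φ κ₂).1 + w.2 * (Φ κ₂).2) + -(w.1 * (Φ y₁).1 + w.2 * (Φ y₁).2) +
        -(w.1 * (Φ y₁).1 + w.2 * (Φ y₁).2)) - ((w.1 * (Φ κ₁).1 + w.2 * (Φ κ₁).2) +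
        -(w.1 * (Φ x₁).1 + w.2 * (Φ x₁).2) + -(w.1 * (Φ x₁).1 + w.2 * (Φ x₁).2))) = 0 ∧
      2 * (((w'.1 * (Φ κ₂).1 + w'.2 * (Φ κ₂).2) + -(w'.1 * (Φ y₁).1 + w'.2 * (Φ y₁).2) +
        -(w'.1 * (Φ y₁).1 + w'.2 * (Φ y₁).2)) - ((w'.1 * (Φ κ₁).1 + w'.2 * (Φ κ₁).2) +
        -(w'.1 * (Φ x₁).1 + w'.2 * (Φ x₁).2) + -(w'.1 * (Φ x₁).1 + w'.2 * (Φ x₁).2))) = 0) := by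
    rintro ⟨h1, h2⟩
    rw [zmod4_two_mul_K, ← z4pair_two, ← z4pair_two, sub_eq_zero] at h1 h2
    have e1 : ψ (w + w) κ₁ = ψ (w + w) κ₂ := by rw [hψ, hψ, h1]
    have e2 : ψ (w' + w') κ₁ = ψ (w' + w') κ₂ := by rw [hψ, hψ, h2]
    have e3 : ψ ((w + w') + (w + w')) κ₁ = ψ ((w + w') + (w + w')) κ₂ := by
      rw [show (w + w') + (w + w') = (w + w) + (w' + w') by abel, hψww (w + w) (w' + w') κ₁,
        hψww (w + w) (w' + w') κ₂, e1, e2]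
    have k1 := RK1 w h2w0 e1
    have k2 := RK1 w' h2w'0 e2
    have k3 := RK1 (w + w') h2ww'0 e3
    rw [show (w + w') + (w + w') = (w + w) + (w' + w') by abel, hψww (w + w) (w' + w') κ₃,
      hψww (w + w) (w' + w') κ₁, k1, k2] at k3
    have : ψ (w + w) κ₁ * ψ (w' + w') κ₁ = 0 := gaussInt_eq_zero_of_eq_neg (by linear_combination k3)
    rcases mul_eq_zero.1 this with h0 | h0
    · have := hψunit (w + w) κ₁; rw [h0, zero_mul] at this; exact zero_ne_one this
    · have := hψunit (w' + w') κ₁; rw [h0, zero_mul] at this; exact zero_ne_one this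
  have ipow3 : ∀ j s : ZMod 4, (⟨0, 1⟩ : GaussianInt) ^ (j + -s + -s).val =
      (⟨0, 1⟩ : GaussianInt) ^ j.val * star ((⟨0, 1⟩ : GaussianInt) ^ s.val) *
        star ((⟨0, 1⟩ : GaussianInt) ^ s.val) := by
    intro j s; rw [ipow_add, ipow_add, star_ipow]
  have ipow3' : ∀ l s t : ZMod 4, (⟨0, 1⟩ : GaussianInt) ^ (l + -s + -t).val =
      (⟨0, 1⟩ : GaussianInt) ^ l.val * star ((⟨0, 1⟩ : GaussianInt) ^ s.val) *
        star ((⟨0, 1⟩ : GaussianInt) ^ t.val) := by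
    intro l s t; rw [ipow_add, ipow_add, star_ipow, star_ipow]
  have hα : ∀ v : ZMod 4 × ZMod 4, ψ v y₁ + ψ v y₂ + ψ v y₃ = ψ v y₁ * (1 + ψ v (y₂ - y₁) + ψ v (y₃ - y₁)) := by
    intro v; rw [hψy v y₂, hψy v y₃, ← hψ, ← hψ]; ring
  have REL_w := table33_two_add_i (w.1 * (Φ (y₂ - y₁)).1 + w.2 * (Φ (y₂ - y₁)).2)
    (w.1 * (Φ (y₃ - y₁)).1 + w.2 * (Φ (y₃ - y₁)).2)
    ((w.1 * (Φ κ₁).1 + w.2 * (Φ κ₁).2) + -(w.1 * (Φ x₁).1 + w.2 * (Φ x₁).2) + -(w.1 * (Φ x₁).1 + w.2 * (Φ x₁).2))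
    ((w.1 * (Φ κ₂).1 + w.2 * (Φ κ₂).2) + -(w.1 * (Φ y₁).1 + w.2 * (Φ y₁).2) + -(w.1 * (Φ y₁).1 + w.2 * (Φ y₁).2))
    (w.1 * (Φ κ₃).1 + w.2 * (Φ κ₃).2)
    ((w.1 * (Φ x₀).1 + w.2 * (Φ x₀).2) + -(w.1 * (Φ x₁).1 + w.2 * (Φ x₁).2) + -(w.1 * (Φ y₁).1 + w.2 * (Φ y₁).2))
  simp only [ipow3, ipow3', ← hψ] at REL_w
  have Rw := REL_w.resolve_left fun hlt =>
    hB w (eq_zero_of_norm_lt (det_mul_eq _ _ _ (∑ v ∈ Y, ψ w v) (by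
    have h := E w hw0
    rw [hcw, hα w] at h
    simp only [star_mul'] at h
    linear_combination (star (ψ w x₁) * star (ψ w y₁)) * h -
      (ψ w κ₂ * star (ψ w y₁) ^ 2 * ⟨2, 1⟩ *
          star (1 + ψ w (y₂ - y₁) +
            ψ w (y₃ - y₁)) * (∑ v ∈ Y, ψ w v) +
        ψ w κ₃ * ⟨2, 1⟩ *
          (1 + ψ w (y₂ - y₁) +
            ψ w (y₃ - y₁)) *
          star (∑ v ∈ Y, ψ w v) * (ψ w y₁ * star (ψ w y₁))) * hψunit w x₁ -
      (ψ w κ₁ * star (ψ w x₁) ^ 2 * star (⟨2, 1⟩ : GaussianInt) *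
          (1 + ψ w (y₂ - y₁) +
            ψ w (y₃ - y₁)) * (∑ v ∈ Y, ψ w v) +
        ψ w κ₃ * ⟨2, 1⟩ *
          (1 + ψ w (y₂ - y₁) +
            ψ w (y₃ - y₁)) *
          star (∑ v ∈ Y, ψ w v)) * hψunit w y₁)) hlt)
  -- the table relation at `w'` (`c = 2 + i`)
  have REL_w' := table33_two_add_i (w'.1 * (Φ (y₂ - y₁)).1 + w'.2 * (Φ (y₂ - y₁)).2)
    (w'.1 * (Φ (y₃ - y₁)).1 + w'.2 * (Φ (y₃ - y₁)).2)
    ((w'.1 * (Φ κ₁).1 + w'.2 * (Φ κ₁).2) + -(w'.1 * (Φ x₁).1 + w'.2 * (Φ x₁).2) + -(w'.1 * (Φ x₁).1 + w'.2 * (Φ x₁).2))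
    ((w'.1 * (Φ κ₂).1 + w'.2 * (Φ κ₂).2) + -(w'.1 * (Φ y₁).1 + w'.2 * (Φ y₁).2) + -(w'.1 * (Φ y₁).1 + w'.2 * (Φ y₁).2))
    (w'.1 * (Φ κ₃).1 + w'.2 * (Φ κ₃).2)
    ((w'.1 * (Φ x₀).1 + w'.2 * (Φ x₀).2) + -(w'.1 * (Φ x₁).1 + w'.2 * (Φ x₁).2) + -(w'.1 * (Φ y₁).1 + w'.2 * (Φ y₁).2))
  simp only [ipow3, ipow3', ← hψ] at REL_w'
  have Rw' := REL_w'.resolve_left fun hlt =>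
    hB w' (eq_zero_of_norm_lt (det_mul_eq _ _ _ (∑ v ∈ Y, ψ w' v) (by
    have h := E w' hw'0
    rw [hcw', hα w'] at h
    simp only [star_mul'] at h
    linear_combination (star (ψ w' x₁) * star (ψ w' y₁)) * h -
      (ψ w' κ₂ * star (ψ w' y₁) ^ 2 * ⟨2, 1⟩ *
          star (1 + ψ w' (y₂ - y₁) +
            ψ w' (y₃ - y₁)) * (∑ v ∈ Y, ψ w' v) +
        ψ w' κ₃ * ⟨2, 1⟩ *
          (1 + ψ w' (y₂ - y₁) +
            ψ w' (y₃ - y₁)) *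
          star (∑ v ∈ Y, ψ w' v) * (ψ w' y₁ * star (ψ w' y₁))) * hψunit w' x₁ -
      (ψ w' κ₁ * star (ψ w' x₁) ^ 2 * star (⟨2, 1⟩ : GaussianInt) *
          (1 + ψ w' (y₂ - y₁) +
            ψ w' (y₃ - y₁)) * (∑ v ∈ Y, ψ w' v) +
        ψ w' κ₃ * ⟨2, 1⟩ *
          (1 + ψ w' (y₂ - y₁) +
            ψ w' (y₃ - y₁)) *
          star (∑ v ∈ Y, ψ w' v)) * hψunit w' y₁)) hlt)
  -- the table relation at `w + w'` (`c = 1 + 2i`), written in the split exponents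
  have REL_ww := table33_one_add_two_i
    ((w + w').1 * (Φ (y₂ - y₁)).1 + (w + w').2 * (Φ (y₂ - y₁)).2)
    ((w + w').1 * (Φ (y₃ - y₁)).1 + (w + w').2 * (Φ (y₃ - y₁)).2)
    (((w + w').1 * (Φ κ₁).1 + (w + w').2 * (Φ κ₁).2) + -((w + w').1 * (Φ x₁).1 + (w + w').2 * (Φ x₁).2) +
      -((w + w').1 * (Φ x₁).1 + (w + w').2 * (Φ x₁).2))
    (((w + w').1 * (Φ κ₂).1 + (w + w').2 * (Φ κ₂).2) + -((w + w').1 * (Φ y₁).1 + (w + w').2 * (Φ y₁).2) +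
      -((w + w').1 * (Φ y₁).1 + (w + w').2 * (Φ y₁).2))
    ((w + w').1 * (Φ κ₃).1 + (w + w').2 * (Φ κ₃).2)
    (((w + w').1 * (Φ x₀).1 + (w + w').2 * (Φ x₀).2) + -((w + w').1 * (Φ x₁).1 + (w + w').2 * (Φ x₁).2) +
      -((w + w').1 * (Φ y₁).1 + (w + w').2 * (Φ y₁).2))
  simp only [ipow3, ipow3', ← hψ] at REL_ww
  have Rww := REL_ww.resolve_left fun hlt =>
    hB (w + w') (eq_zero_of_norm_lt (det_mul_eq _ _ _ (∑ v ∈ Y, ψ (w + w') v) (by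
    have h := E (w + w') hww'0
    rw [hcww', hα (w + w')] at h
    simp only [star_mul'] at h
    linear_combination (star (ψ (w + w') x₁) * star (ψ (w + w') y₁)) * h -
      (ψ (w + w') κ₂ * star (ψ (w + w') y₁) ^ 2 * ⟨1, 2⟩ *
          star (1 + ψ (w + w') (y₂ - y₁) +
            ψ (w + w') (y₃ - y₁)) *
          (∑ v ∈ Y, ψ (w + w') v) +
        ψ (w + w') κ₃ * ⟨1, 2⟩ *
          (1 + ψ (w + w') (y₂ - y₁) +
            ψ (w + w') (y₃ - y₁)) *
          star (∑ v ∈ Y, ψ (w + w') v) * (ψ (w + w') y₁ * star (ψ (w + w') y₁))) * hψunit (w + w') x₁ -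
      (ψ (w + w') κ₁ * star (ψ (w + w') x₁) ^ 2 * star (⟨1, 2⟩ : GaussianInt) *
          (1 + ψ (w + w') (y₂ - y₁) +
            ψ (w + w') (y₃ - y₁)) *
          (∑ v ∈ Y, ψ (w + w') v) +
        ψ (w + w') κ₃ * ⟨1, 2⟩ *
          (1 + ψ (w + w') (y₂ - y₁) +
            ψ (w + w') (y₃ - y₁)) *
          star (∑ v ∈ Y, ψ (w + w') v)) * hψunit (w + w') y₁)) hlt)
  -- the `K` of `w + w'` is `K + K'`
  have eK : (((w + w').1 * (Φ κ₂).1 + (w + w').2 * (Φ κ₂).2) + -((w + w').1 * (Φ y₁).1 + (w + w').2 * (Φ y₁).2) +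
      -((w + w').1 * (Φ y₁).1 + (w + w').2 * (Φ y₁).2)) -
      (((w + w').1 * (Φ κ₁).1 + (w + w').2 * (Φ κ₁).2) + -((w + w').1 * (Φ x₁).1 + (w + w').2 * (Φ x₁).2) +
      -((w + w').1 * (Φ x₁).1 + (w + w').2 * (Φ x₁).2)) =
      (((w.1 * (Φ κ₂).1 + w.2 * (Φ κ₂).2) + -(w.1 * (Φ y₁).1 + w.2 * (Φ y₁).2) + -(w.1 * (Φ y₁).1 + w.2 * (Φ y₁).2)) -
        ((w.1 * (Φ κ₁).1 + w.2 * (Φ κ₁).2) + -(w.1 * (Φ x₁).1 + w.2 * (Φ x₁).2) + -(w.1 * (Φ x₁).1 + w.2 * (Φ x₁).2))) +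
      (((w'.1 * (Φ κ₂).1 + w'.2 * (Φ κ₂).2) + -(w'.1 * (Φ y₁).1 + w'.2 * (Φ y₁).2) + -(w'.1 * (Φ y₁).1 + w'.2 * (Φ y₁).2)) -
        ((w'.1 * (Φ κ₁).1 + w'.2 * (Φ κ₁).2) + -(w'.1 * (Φ x₁).1 + w'.2 * (Φ x₁).2) +
          -(w'.1 * (Φ x₁).1 + w'.2 * (Φ x₁).2))) := by
    simp only [Prod.fst_add, Prod.snd_add]; ring
  rw [eK, z4pair_add_left w w' (Φ (y₂ - y₁)), z4pair_add_left w w' (Φ (y₃ - y₁))] at Rww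
  exact combine33 _ _ _ _ _ _ hX1 hX2 hX3 hK ⟨Rw, Rw', Rww⟩

end Main

/-! ## The TPP statements -/

section DihedralLike

variable {A : Type} [AddCommGroup A] [DecidableEq A] [Fintype A] {G : Type} [Group G] [DecidableEq G]
  {ρ τ : A → G} {c₀ : A} {S T U : Finset G}

/-- **No `(3,3 | 3,3 | e,e)` law triple over `A ↠ ℤ₄ × ℤ₄`.**  Dihedral-like `G` over `A` (any `c₀`), `Φ : A →+ ZMod 4 × ZMod 4`
onto; a TPP triple with `|S₀| = |S₁| = 3`, `|T₀| = |T₁| = 3`, `|U₀| = |U₁|`.  Then `3|S||T||U| + 8 ≠ 8|A|`. [folklore] -/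
theorem no_law_cube_33e_of_onto_z4z4
    (hρρ : ∀ a b, ρ a * ρ b = ρ (a + b)) (hρτ : ∀ a b, ρ a * τ b = τ (b - a))
    (hτρ : ∀ a b, τ a * ρ b = τ (a + b)) (hττ : ∀ a b, τ a * τ b = ρ (c₀ + b - a))
    (hρ : Function.Injective ρ) (hτ : Function.Injective τ) (hne : ∀ a b, ρ a ≠ τ b)
    (hsurj : ∀ g, (∃ a, ρ a = g) ∨ (∃ a, τ a = g))
    (Φ : A →+ ZMod 4 × ZMod 4) (hΦ : Function.Surjective Φ)
    (h : TripleProductProperty S T U)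
    (hS₀ : (univ.filter fun a : A => ρ a ∈ S).card = 3) (hS₁ : (univ.filter fun a : A => τ a ∈ S).card = 3)
    (hT₀ : (univ.filter fun a : A => ρ a ∈ T).card = 3) (hT₁ : (univ.filter fun a : A => τ a ∈ T).card = 3)
    (hU : (univ.filter fun a : A => ρ a ∈ U).card = (univ.filter fun a : A => τ a ∈ U).card)
    (hV : 3 * (S.card * T.card * U.card) + 8 = 8 * Fintype.card A) : False := by
  classical
  obtain ⟨W, X, Y, κ₁, κ₂, κ₃, x₀, hWc, hXc, -, hn, i₁, i₂, i₃, d₁₂, d₁₃, d₂₃, hcover⟩ :=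
    cube_shifted_form_of_law hρρ hρτ hτρ hττ hρ hτ hne hsurj h (by rw [hS₀, hS₁]) (by rw [hT₀, hT₁]) hU hV
  rw [hS₀] at hWc
  rw [hT₀] at hXc
  have hYodd : Odd Y.card := by
    obtain ⟨k, hk⟩ := even_card_of_onto_z4z4 Φ hΦ
    rw [hWc, hXc] at hn
    by_contra hodd
    rw [Nat.not_odd_iff_even] at hodd
    obtain ⟨j, hj⟩ := hodd
    omega
  exact no_cube_form_33_of_onto_z4z4 Φ hΦ hWc hXc hYodd i₁ i₂ i₃ d₁₂ d₁₃ d₂₃ hcover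

/-- The same with the size-`3` pairs in `T` and `U` (rotation `(T, U, S)`). [folklore] -/
theorem no_law_cube_e33_of_onto_z4z4
    (hρρ : ∀ a b, ρ a * ρ b = ρ (a + b)) (hρτ : ∀ a b, ρ a * τ b = τ (b - a))
    (hτρ : ∀ a b, τ a * ρ b = τ (a + b)) (hττ : ∀ a b, τ a * τ b = ρ (c₀ + b - a))
    (hρ : Function.Injective ρ) (hτ : Function.Injective τ) (hne : ∀ a b, ρ a ≠ τ b)
    (hsurj : ∀ g, (∃ a, ρ a = g) ∨ (∃ a, τ a = g))
    (Φ : A →+ ZMod 4 × ZMod 4) (hΦ : Function.Surjective Φ)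
    (h : TripleProductProperty S T U)
    (hS : (univ.filter fun a : A => ρ a ∈ S).card = (univ.filter fun a : A => τ a ∈ S).card)
    (hT₀ : (univ.filter fun a : A => ρ a ∈ T).card = 3) (hT₁ : (univ.filter fun a : A => τ a ∈ T).card = 3)
    (hU₀ : (univ.filter fun a : A => ρ a ∈ U).card = 3) (hU₁ : (univ.filter fun a : A => τ a ∈ U).card = 3)
    (hV : 3 * (S.card * T.card * U.card) + 8 = 8 * Fintype.card A) : False :=
  no_law_cube_33e_of_onto_z4z4 hρρ hρτ hτρ hττ hρ hτ hne hsurj Φ hΦ h.rotate hT₀ hT₁ hU₀ hU₁ hS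
    (by rw [← hV]; ring)

/-- The same with the size-`3` pairs in `U` and `S` (rotation `(U, S, T)`). [folklore] -/
theorem no_law_cube_3e3_of_onto_z4z4
    (hρρ : ∀ a b, ρ a * ρ b = ρ (a + b)) (hρτ : ∀ a b, ρ a * τ b = τ (b - a))
    (hτρ : ∀ a b, τ a * ρ b = τ (a + b)) (hττ : ∀ a b, τ a * τ b = ρ (c₀ + b - a))
    (hρ : Function.Injective ρ) (hτ : Function.Injective τ) (hne : ∀ a b, ρ a ≠ τ b)
    (hsurj : ∀ g, (∃ a, ρ a = g) ∨ (∃ a, τ a = g))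
    (Φ : A →+ ZMod 4 × ZMod 4) (hΦ : Function.Surjective Φ)
    (h : TripleProductProperty S T U)
    (hS₀ : (univ.filter fun a : A => ρ a ∈ S).card = 3) (hS₁ : (univ.filter fun a : A => τ a ∈ S).card = 3)
    (hT : (univ.filter fun a : A => ρ a ∈ T).card = (univ.filter fun a : A => τ a ∈ T).card)
    (hU₀ : (univ.filter fun a : A => ρ a ∈ U).card = 3) (hU₁ : (univ.filter fun a : A => τ a ∈ U).card = 3)
    (hV : 3 * (S.card * T.card * U.card) + 8 = 8 * Fintype.card A) : False :=
  no_law_cube_33e_of_onto_z4z4 hρρ hρτ hτρ hττ hρ hτ hne hsurj Φ hΦ h.rotate.rotate hU₀ hU₁ hS₀ hS₁ hT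
    (by rw [← hV]; ring)

end DihedralLike

end Summit.MatrixMultiplication.OmegaCensus
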